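import Summits.HodgeConjecture.HodgeConjecture.Theorems.Ring2AbelianAllAndreSpreadNumerical
import Summits.HodgeConjecture.HodgeConjecture.Theorems.Ring2AbelianAllAndreFibreClassKernelHolds
import Literature.AlgebraicGeometry.HodgeTheory.VerticalSupportLines
import HarnessLib

/-!
# Ring 2 · sub-cell AbelianAll (ALL ABELIAN VARIETIES), André axis, part XX-a — THE SPREADING STATEMENT IS A
# THEOREM MODULO VERDIER 1976 on every smooth projective family over a smooth projective curve (Grothendieck's
# algebraic "partie fixe": a class algebraic on EVERY fibre agrees on every fibre with ONE algebraic class of the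
# total space), from spreading of SUPPORTS + vertical support lines + Deligne's `Ker j_{t*} ∩ Im j_t^* = 0`; hence
# every K[SpreadCurve] row of parts XIX-a/b is a K[Verdier] row, with NO rationality hypothesis

HONEST FRAMING (page 1, verbatim): **research route, not a corollary; conditional on HC_CM plus one named
minimal statement.** Cell line: research route conditional on HC_CM; not a corollary; Q11.4-sentence-2 already
refuted in dim ≥ 3. Nothing in this file proves a case of the Hodge conjecture for an abelian variety. `HC_CM`
(`Theses.RankFourFaces.CMAbelianHodge`) and `HC_AV` (`Theses.PadicSemiregularLift.HodgeAbelianVarieties`) are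
BINDERS wherever they occur; the reduction item `CMToAbelian` (stmt-HodgeConjecture-16267) is NOT closed here.

## What this part does (RING2-MAP §AbelianAll owed item o33: discharge the spreading statement)

Parts XIX-a…f carried the classical spreading of fibrewise algebraic CLASSES over a curve (Voisin II §3.3.1 with the
device of the proof of Thm. 10.19; Charles–Schnell, proof of Prop. 11.3.11) as the hypothesis shape `SpreadCurve[]`
= the Literature named fact `HodgeTheory.spread_algebraicClasses_over_smoothCurve` (debt +1, label K[SpreadCurve]).
Its SUPPORT half is a tree theorem modulo Verdier's generic local triviality (`exists_spread_supports_of_verdier`).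
This part proves that ON THE FAMILIES THE ANDRÉ AXIS USES — smooth projective total space over a smooth projective
curve — the support half ALREADY GIVES THE CLASS STATEMENT, with no Hilbert scheme, no monodromy, no rationality:

* §1 **`exists_algebraic_lift_of_verdier`**: `f : 𝒳 ⟶ S` a smooth projective family of relative dimension `d` over a
  smooth projective curve `S`, `𝒳` smooth projective of dimension `d + 1`, `W ∈ H²ᵖ(𝒳(ℂ); ℂ)` algebraic on EVERY
  fibre ⟹ some `η ∈ Nᵖ H²ᵖ(𝒳(ℂ); ℂ)` has `η|_{𝒳_s} = W|_{𝒳_s}` for every `s`. PROOF (the device of the tree's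
  `PencilStepBelowMiddleOfVerdier`, with hard Lefschetz replaced by Deligne's kernel identity): (1) spreading of
  SUPPORTS: a Zariski-closed `𝒵 ⊆ 𝒳` of codimension `≥ p` with `W|_{𝒳_t}` dying off `𝒵_t` for `t` off a proper closed
  `S'`; (2) VERTICAL SUPPORT LINES (`exists_verticalSupportLines`: purity, Stein factorisation and the divisor line —
  monodromy-free): off a proper closed `S₀`, every class of `H^{2p+2}(𝒳)` dying off `𝒵 ∩ f⁻¹(t)` is `f^* η ∪ a` with
  `a` in the span of a fixed set of algebraic classes of `𝒳`; (3) at a good `t`, `(j_t)_* j_t^* W = κ_t · f^* η ∪ W`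
  (projection formula; `(j_t)_* 1 = κ_t f^* η`, `κ_t ≠ 0`, divisor line + Wirtinger) dies off `𝒵 ∩ f⁻¹(t)` (support
  property of Gysin maps), so `(j_t)_* j_t^*(κ_t W − a_t) = 0`; (4) DELIGNE `Ker j_{t*} ∩ Im j_t^* = 0` at every fibre
  (part XII-e's tree theorem `deligne1971_fibreGysin_injOn_restricted_holds` + André's flatness (A4)):
  `j_s^*(κ_t W − a_t) = 0` for every `s`; `η := κ_t⁻¹ a_t`.
* §2 THE ENGINE of part XIX-a on compact abelian pencils WITHOUT `SpreadCurve[]` and WITHOUT rationality.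
* §3 EVERY K[SpreadCurve] ROW OF PARTS XIX-a/b AS A K[Verdier] ROW: (2) ⟺ (L∀), (4) ⟺ (L), (3) ⟹ (L),
  `HC_AV ⟹ (L∀)`, **`HC_AV ⟺ HC_CM ∧ (L) ⟺ HC_CM ∧ (L∀) ⟺ HC_CM ∧ Num^CM`** (mod Lemme 6.3.1),
  `CMToAbelian ⟺ (HC_CM → (L)) ⟺ (HC_CM → Num^CM)`; under `HC_CM` all six nodes coincide.
What the axis used of `SpreadCurve[]` — the engine's conclusion, §2 — thus follows from Verdier; the Literature
fact itself (quasi-projective total space, singular fibres over a bad set: no Gysin maps there) is NOT claimed.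

HONEST ACCOUNTING. `Motives.Verdier1976_genericLocalTriviality` (Verdier 1976, Thm. (3.3) + (4.14), Cor. (5.1)) is
a named fact of the tree ALREADY carried by `charlesSchnell_algebraicityLocus_iUnion_closed`, by the support half and
by the pencil step; this part moves the André axis's lift rows from a fact introduced by this seat (debt +1) to that
pre-existing one, and drops the rationality binder. Nothing is minimal; nothing closes stmt-16267/16268.
EDGE LABELS for RING2-MAP: §1–§3 K[Verdier] (`hGT` carried as a hypothesis); §0 unconditional. No `def`, no
`sorry`, no new node; axioms standard.

References: Verdier1976 (Thm. (3.3), (4.14), Cor. (5.1)); VoisinHodgeII2003 (§2.1.1, §3.3.1, §4.3.1 Thm. 4.18,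
§10.2.1 proof of Thm. 10.19); CharlesSchnell2014Notes (Prop. 11.3.5, Cor. 11.3.6, Prop. 11.3.11);
DecataldoMigliorini2009 (§4 proof of Prop. 4.5); Fulton1998 (§19.1 Lemma 19.1.1, Example 19.1.11, §19.2);
DeligneHodgeII1971 (Thm. 4.1.1, Cor. 4.1.2); Andre1996Motifs (§5.1 (A3)–(A4) p. 25, Lemme 6.3.1 p. 31, Remarque 2
p. 33); Milne2020HodgeClassesAV (Prop. 1); Kleiman1968AlgebraicCycles (§3 D(X)); HatcherAT2002 (§3.3 Cor. 3.37).
-/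

noncomputable section

set_option linter.dupNamespace false

namespace Summit.HodgeConjecture.HodgeConjecture.Ring2.AbelianAll

open CategoryTheory AlgebraicGeometry
open Literature.AlgebraicGeometry Literature.AlgebraicGeometry.Motives
open Literature.AlgebraicGeometry.HodgeTheory
open Literature.AlgebraicTopology.SingularHomology
open Literature.AlgebraicGeometry.Andre1996 (andre1996_cmAnchoredPencil)
open Literature.AlgebraicGeometry.Deligne1982 (cmLocus)
open Summit.HodgeConjecture.HodgeConjecture
open Summit.HodgeConjecture.HodgeConjecture.Theses
open Summit.HodgeConjecture.HodgeConjecture.Ring2.Deform (CompactAbelianPencilVHC compactAbelianPencilVHC_of_HC_AV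
  HC_CM_of_HC_AV)

variable {𝒳 S : SchemeOver ℂ}

/-! ## §0 Carriers: `H²` of a smooth projective curve is non-zero; a smooth projective family is onto its base -/

/-- **`H²(S(ℂ); ℂ) ≠ 0` for a smooth projective curve `S`** (`b₂ = b₀ = 1`: Poincaré duality on the closed oriented
surface `S(ℂ)`, Hatcher Cor. 3.37, and path-connectedness). [cite: HatcherAT2002, §3.3 Cor. 3.37] -/
theorem exists_ne_zero_complexBetti_two_of_curve (hS : IsSmoothProjective 1 S) :
    ∃ η : complexBetti S 2, η ≠ 0 := by
  have h1 : Module.finrank ℂ (complexBetti S 2) = 1 := finrank_complexBetti_two_of_curve hS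
  haveI := Module.nontrivial_of_finrank_eq_succ h1
  exact exists_ne 0

/-- **A smooth projective family over a smooth projective curve is surjective**: its image is closed (`f` is
proper) and contains the underlying point of every complex point (each fibre is a non-empty variety); a closed
subset of the Jacobson space `S` containing every closed point is everything (`exists_complexPoint_pt_not_mem`).
[folklore] -/
theorem surjective_left_of_isSmoothProjectiveFamily {d : ℕ} {f : 𝒳 ⟶ S} (hS : IsSmoothProjective 1 S)
    (hf : IsSmoothProjectiveFamily f d) : Surjective f.left := by
  haveI : IsProper f.left := hf.isProper
  haveI : SmoothOfRelativeDimension 1 S.hom := hS.smoothOfRelativeDimension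
  haveI : Smooth S.hom := SmoothOfRelativeDimension.smooth 1 S.hom
  haveI : LocallyOfFiniteType S.hom := inferInstance
  have hcl : IsClosed (Set.range f.left.base) := f.left.isClosedMap.isClosed_range
  have huniv : Set.range f.left.base = Set.univ := by
    by_contra h
    obtain ⟨t, ht⟩ := exists_complexPoint_pt_not_mem hcl h
    haveI : IrreducibleSpace (fiberOver f t).left := (hf.isSmoothProjective t).irreducibleSpace
    obtain ⟨z⟩ : Nonempty (fiberOver f t).left := inferInstance
    exact ht ⟨(fiberι f t).left.base z, apply_fiberι_base_eq_pt f t z⟩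
  exact ⟨fun s ↦ (huniv ▸ Set.mem_univ s : s ∈ Set.range f.left.base)⟩

/-! ## §1 The theorem: fibrewise algebraic ⟹ ONE algebraic class of the total space, granted Verdier only -/

set_option maxHeartbeats 800000 in
/-- **GROTHENDIECK'S ALGEBRAIC "PARTIE FIXE" OVER A CURVE, GRANTED VERDIER'S GENERIC LOCAL TRIVIALITY ALONE.**
Let `S` be a smooth projective curve, `𝒳` smooth projective of dimension `d + 1`, `f : 𝒳 ⟶ S` a smooth projective
family of relative dimension `d`, and `W ∈ H²ᵖ(𝒳(ℂ); ℂ)` a class whose restriction to EVERY fibre is algebraic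
(`W|_{𝒳_s} ∈ Nᵖ H²ᵖ(𝒳_s(ℂ); ℂ)`). Then there is an ALGEBRAIC class `η ∈ Nᵖ H²ᵖ(𝒳(ℂ); ℂ)` of the total space with
`η|_{𝒳_s} = W|_{𝒳_s}` for every `s`. No rationality or Hodge-type hypothesis on `W`. Proof in the module docstring:
`p = 0` (`N⁰ = ⊤`), `p > d` (fibre cohomology `0`), empty base; else spreading of SUPPORTS
(`exists_spread_supports_of_verdier`, codimension by `le_coheight_iff_height_add_le`), VERTICAL SUPPORT LINES
(`exists_verticalSupportLines`) at a good `t`, applied to `(j_t)_* j_t^* W` (dies off `𝒵 ∩ f⁻¹(t)` by the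
support property `complexGysin_restrictCompl_eq_zero`), the divisor line `(j_t)_* 1 = κ_t f^* η`, `κ_t ≠ 0`
(`exists_complexGysin_fiberι_one_eq_smul_map`, Wirtinger), the projection formula (`complexGysin_cup`), and
DELIGNE'S `Ker j_{t*} ∩ Im j_t^* = 0` at every fibre (`restrict_eq_zero_of_complexGysin_eq_zero`, part XII-e).
[cite: VoisinHodgeII2003, §3.3.1 and §10.2.1 (proof of Thm. 10.19), §4.3.1 Thm. 4.18]
[cite: CharlesSchnell2014Notes, Prop. 11.3.11 (proof) and Prop. 11.3.5] [cite: Verdier1976, Cor. (5.1)]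
[cite: DecataldoMigliorini2009, §4 proof of Prop. 4.5] [cite: Fulton1998, §19.1 Lemma 19.1.1 and Example 19.1.11]
[cite: DeligneHodgeII1971, Thm. 4.1.1 and Cor. 4.1.2] -/
theorem exists_algebraic_lift_of_verdier (hGT : Verdier1976_genericLocalTriviality) {d : ℕ} {f : 𝒳 ⟶ S}
    (hS : IsSmoothProjective 1 S) (h𝒳 : IsSmoothProjective (d + 1) 𝒳) (hf : IsSmoothProjectiveFamily f d)
    {p : ℕ} (W : complexBetti 𝒳 (2 * p))
    (halg : ∀ s : ComplexPoints S, complexBetti.map (fiberι f s) (2 * p) W ∈ algebraicClasses (fiberOver f s) p) :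
    ∃ η ∈ algebraicClasses 𝒳 p, ∀ s : ComplexPoints S,
      complexBetti.map (fiberι f s) (2 * p) η = complexBetti.map (fiberι f s) (2 * p) W := by
  rcases Nat.eq_zero_or_pos p with rfl | hp
  · exact ⟨W, by rw [algebraicClasses_zero]; exact Submodule.mem_top, fun s ↦ rfl⟩
  rcases le_or_gt p d with hpd | hdp
  swap
  · refine ⟨0, Submodule.zero_mem _, fun s ↦ ?_⟩
    haveI := subsingleton_complexBetti (hf.isSmoothProjective s) (show 2 * d < 2 * p by omega)
    exact Subsingleton.elim _ _
  rcases isEmpty_or_nonempty (ComplexPoints S) with hSe | ⟨⟨s₁⟩⟩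
  · exact ⟨0, Submodule.zero_mem _, fun s ↦ (IsEmpty.false s).elim⟩
  -- standing instances
  haveI hSsm : SmoothOfRelativeDimension 1 S.hom := hS.smoothOfRelativeDimension
  haveI : Smooth S.hom := SmoothOfRelativeDimension.smooth 1 S.hom
  haveI : LocallyOfFiniteType S.hom := inferInstance
  haveI : IrreducibleSpace S.left := hS.irreducibleSpace
  haveI : IsProper S.hom := IsSmoothProjective.isProper_holds hS
  haveI : IsProper f.left := hf.isProper
  haveI : Surjective f.left := surjective_left_of_isSmoothProjectiveFamily hS hf
  have h𝒳qp : IsQuasiProjectiveOver 𝒳 := IsQuasiProjectiveOver.of_isProjectiveOver h𝒳.isProjectiveOver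
  have huniv : (∅ : Set S.left) ≠ Set.univ := fun h ↦ (h ▸ Set.mem_univ s₁.pt : s₁.pt ∈ (∅ : Set S.left))
  -- (1) spreading of the fibrewise SUPPORTS, granted Verdier
  obtain ⟨𝒵, h𝒵, -, htot, S', hS', -, hS'ne, hdies⟩ :=
    exists_spread_supports_of_verdier hGT (d := d) (q := p) f h𝒳qp isClosed_empty huniv
      (fun t _ ↦ hf.isSmoothProjective t) W (fun t _ ↦ halg t)
  have hc𝒵 : ∀ z ∈ 𝒵, (p : ℕ∞) ≤ Order.coheight z := fun z hz ↦ by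
    rw [le_coheight_iff_height_add_le h𝒳 z p]
    exact htot z hz
  -- (2) vertical support lines on `𝒳`, for a generator `η` of `H²(S)`
  obtain ⟨η, hη⟩ := exists_ne_zero_complexBetti_two_of_curve hS
  obtain ⟨e, he⟩ : ∃ e, p + e + 1 = d + 1 := ⟨d - p, by omega⟩
  have h𝒳' : IsSmoothProjective (p + e + 1) 𝒳 := by rw [he]; exact h𝒳
  obtain ⟨S₀, hS₀, hS₀ne, s, hs, hlines⟩ := exists_verticalSupportLines h𝒳' hS f h𝒵 hc𝒵 hη
  -- a good point `t ∉ S' ∪ S₀`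
  obtain ⟨t, ht⟩ := exists_complexPoint_pt_not_mem (hS'.union hS₀)
    (union_ne_univ_of_isClosed hS' hS'ne hS₀ hS₀ne)
  have htS' : t.pt ∉ S' := fun h ↦ ht (Or.inl h)
  have htS₀ : t.pt ∉ S₀ := fun h ↦ ht (Or.inr h)
  have hY : IsSmoothProjective d (fiberOver f t) := hf.isSmoothProjective t
  -- notation
  have hμ : complexOrientationFamily.HasPoincareDuality := OrientationFamily.hasPoincareDuality _
  have hSupp := gysinMap_restrictCompl_eq_zero_of_field.{0, 0} ℂ
  haveI : IsClosedImmersion (fiberι f t).left := isClosedImmersion_fiberι_left f t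
  have hab : 2 * p + 2 * (d + 1) = 2 * (p + 1) + 2 * d := by ring
  have hab₀ : 0 + 2 * (d + 1) = 2 + 2 * d := by ring
  have h2 : 2 + 2 * p = 2 * (p + 1) := by ring
  have h2' : 2 * p + 2 = 2 * (p + 1) := by ring
  -- (3a) `(j_t)_* (j_t^* W)` dies off `𝒵 ∩ f⁻¹(t)`
  have hpre : (fiberι f t).left.base ⁻¹' (𝒵 ∩ f.left.base ⁻¹' {t.pt}) = (fiberι f t).left.base ⁻¹' 𝒵 := by
    ext z
    simp only [Set.mem_preimage, Set.mem_inter_iff, Set.mem_singleton_iff]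
    exact ⟨fun h ↦ h.1, fun h ↦ ⟨h, apply_fiberι_base_eq_pt f t z⟩⟩
  have hgdies : complexBetti.restrictCompl 𝒳 (𝒵 ∩ f.left.base ⁻¹' {t.pt}) (2 * (p + 1))
      (complexGysin complexOrientationFamily hY h𝒳 (fiberι f t) hab
        (complexBetti.map (fiberι f t) (2 * p) W)) = 0 := by
    refine complexGysin_restrictCompl_eq_zero hSupp complexOrientationFamily hμ hY h𝒳 (fiberι f t) hab
      (h𝒵.inter (t.isClosed_pt.preimage f.left.continuous)) _ ?_
    rw [hpre]
    exact hdies t htS'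
  obtain ⟨at_, hat_, hF2⟩ := hlines t htS₀ _ hgdies
  -- (3b) the divisor line of the fibre: `(j_t)_* 1 = κ • f^* η`, `κ ≠ 0`
  obtain ⟨κ, hκ⟩ := exists_complexGysin_fiberι_one_eq_smul_map complexOrientationFamily h𝒳 hS f t hY hη
  have hκ0 : κ ≠ 0 := by
    rintro rfl
    rw [zero_smul] at hκ
    haveI := connectedSpace_complexPoints hY
    obtain ⟨P⟩ : Nonempty (ComplexPoints (fiberOver f t)) := inferInstance
    exact complexGysin_one_ne_zero_of_stalkMap_surjective complexOrientationFamily h𝒳 hY (fiberι f t) P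
      ((fiberι f t).left.stalkMap_surjective P.pt) (e := 1) (by omega) hκ
  -- (3c) projection formula for `j_t`: `(j_t)_* (j_t^* b) = b ∪ (j_t)_* 1 = κ • (f^* η ∪ b)`
  have hprojι : ∀ b : complexBetti 𝒳 (2 * p),
      complexGysin complexOrientationFamily hY h𝒳 (fiberι f t) hab (complexBetti.map (fiberι f t) (2 * p) b) =
        κ • cupProduct h2 (complexBetti.map f 2 η) b := fun b ↦ by
    have h3 := complexGysin_cup hμ hY h𝒳 (fiberι f t) (Nat.add_zero (2 * p)) hab hab₀ h2' b
      (singularCohomology.one ℂ (ComplexPoints (fiberOver f t)))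
    rw [cupProduct_one] at h3
    rw [h3, hκ, map_smul, cupProduct_gradedComm_holds ℂ _ h2' h2 b, Even.neg_one_pow ⟨2 * p, by ring⟩,
      one_smul]
  -- hence `f^* η ∪ (κ • W − a_t) = 0`, i.e. `(j_t)_* j_t^* (κ • W − a_t) = 0`
  have hkey : cupProduct h2 (complexBetti.map f 2 η) (κ • W - at_) = 0 := by
    rw [map_sub, map_smul, ← hprojι W, hF2, sub_self]
  have hιy : complexGysin complexOrientationFamily hY h𝒳 (fiberι f t) hab
      (complexBetti.map (fiberι f t) (2 * p) (κ • W - at_)) = 0 := by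
    rw [hprojι, hkey, smul_zero]
  -- (4) Deligne: `Ker j_{t*} ∩ Im j_t^* = 0`, at every fibre
  have hall : ∀ s' : ComplexPoints S, complexBetti.map (fiberι f s') (2 * p) (κ • W - at_) = 0 := fun s' ↦
    restrict_eq_zero_of_complexGysin_eq_zero hS hf h𝒳 hab t s' (κ • W - at_) hιy
  -- (5) the lift `η := κ⁻¹ • a_t`
  have hsN : Submodule.span ℂ s ≤ algebraicClasses 𝒳 p := Submodule.span_le.2 fun r hr ↦ (hs r hr).1
  refine ⟨κ⁻¹ • at_, Submodule.smul_mem _ _ (hsN hat_), fun s' ↦ ?_⟩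
  have h := hall s'
  rw [map_sub, map_smul, sub_eq_zero] at h
  rw [map_smul, ← h, smul_smul, inv_mul_cancel₀ hκ0, one_smul]

/-! ## §2 The engine of part XIX-a on compact pencils of abelian varieties — no `SpreadCurve[]`, no rationality -/

/-- **THE ENGINE, GRANTED VERDIER ONLY** (compare part XIX-a's `exists_algebraic_lift_of_forall_mem_algebraicClasses`,
which needed `SpreadCurve[]` AND rational fibre restrictions): on a compact pencil `f : 𝒳 ⟶ S` of abelian
`d`-folds, a global class `W ∈ H²ᵖ(𝒳(ℂ); ℂ)` algebraic on EVERY fibre agrees on EVERY fibre with ONE algebraic class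
of the `(d+1)`-dimensional total space. [cite: VoisinHodgeII2003, §3.3.1 and §10.2.1 (proof of Thm. 10.19)]
[cite: CharlesSchnell2014Notes, Prop. 11.3.11 (proof) and Prop. 11.3.5] [cite: Verdier1976, Cor. (5.1)]
[cite: Andre1996Motifs, §5.1 (A3)–(A4) (p. 25)] -/
theorem exists_algebraic_lift_of_forall_mem_algebraicClasses_of_verdier (hGT : Verdier1976_genericLocalTriviality)
    {d : ℕ} {f : 𝒳 ⟶ S} (hf : IsCompactAbelianPencil f d) {p : ℕ} (W : complexBetti 𝒳 (2 * p))
    (halg : ∀ s : ComplexPoints S, complexBetti.map (fiberι f s) (2 * p) W ∈ algebraicClasses (fiberOver f s) p) :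
    ∃ η ∈ algebraicClasses 𝒳 p, ∀ s : ComplexPoints S,
      complexBetti.map (fiberι f s) (2 * p) η = complexBetti.map (fiberι f s) (2 * p) W :=
  exists_algebraic_lift_of_verdier hGT hf.isSmoothProjective_base hf.isSmoothProjective_total
    hf.isSmoothProjectiveFamily W halg


/-! ## §3 Transport = lift and the exactness rows of parts XIX-a/b, now K[Verdier] -/

/-- **(2) ⟹ (L∀), granted Verdier** (part XIX-a's `algebraicFixedPart_of_compactAbelianPencilVHC` with
`SpreadCurve[]` replaced by `Verdier1976_genericLocalTriviality`): transport makes the invariant class algebraic on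
EVERY fibre, and the engine of §2 lifts it. [cite: Milne2020HodgeClassesAV, Prop. 1, last line of the proof (p. 8)]
[cite: Verdier1976, Cor. (5.1)] -/
theorem algebraicFixedPart_of_compactAbelianPencilVHC_of_verdier (hGT : Verdier1976_genericLocalTriviality)
    (h₂ : CompactAbelianPencilVHC) : AlgebraicFixedPart := by
  intro d 𝒳 S f hf p W hW s₀ h₀
  obtain ⟨η, hη, hηW⟩ := exists_algebraic_lift_of_forall_mem_algebraicClasses_of_verdier hGT hf W
    (h₂ f hf p W hW ⟨s₀, h₀⟩)
  exact ⟨η, hη, hηW s₀⟩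

/-- **(2) ⟺ (L∀), granted Verdier**: variational Hodge on compact pencils of abelian varieties IS the algebraic
fixed part. No `HC_CM`. [cite: Milne2020HodgeClassesAV, Prop. 1 (p. 7)] [cite: Verdier1976, Cor. (5.1)] -/
theorem algebraicFixedPart_iff_compactAbelianPencilVHC_of_verdier (hGT : Verdier1976_genericLocalTriviality) :
    AlgebraicFixedPart ↔ CompactAbelianPencilVHC :=
  ⟨compactAbelianPencilVHC_of_algebraicFixedPart, algebraicFixedPart_of_compactAbelianPencilVHC_of_verdier hGT⟩

/-- **(4) ⟹ (L), granted Verdier**: transport out of the CM fibre makes the class algebraic on every fibre; the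
engine lifts it; read the lift at the CM fibre. [cite: Andre1996Motifs, §5.1 (A3) (p. 25) and §6.3 a) (p. 33)]
[cite: Verdier1976, Cor. (5.1)] -/
theorem cmFibreAlgebraicLift_of_cmAnchoredTransport_of_verdier (hGT : Verdier1976_genericLocalTriviality)
    (h₄ : CMAnchoredTransport) : CMFibreAlgebraicLift := by
  intro d 𝒳 S f hf p W hW t ht h₀
  obtain ⟨η, hη, hηW⟩ := exists_algebraic_lift_of_forall_mem_algebraicClasses_of_verdier hGT hf W
    (h₄ f hf p W hW t ht h₀)
  exact ⟨η, hη, hηW t⟩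

/-- **(4) ⟺ (L), granted Verdier**: CM-anchored transport IS the cycle-theoretic lift at CM fibres. No `HC_CM`.
[cite: Andre1996Motifs, §6.3 a) (p. 33)] [cite: Verdier1976, Cor. (5.1)] -/
theorem cmFibreAlgebraicLift_iff_cmAnchoredTransport_of_verdier (hGT : Verdier1976_genericLocalTriviality) :
    CMFibreAlgebraicLift ↔ CMAnchoredTransport :=
  ⟨cmAnchoredTransport_of_cmFibreAlgebraicLift, cmFibreAlgebraicLift_of_cmAnchoredTransport_of_verdier hGT⟩

/-- **(3) ⟹ (L), granted Verdier** ((3) ⟹ (4) ⟹ (L)). [cite: Andre1996Motifs, §6.3 a) (p. 33)] -/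
theorem cmFibreAlgebraicLift_of_cmPointedPencilVHC_of_verdier (hGT : Verdier1976_genericLocalTriviality)
    (h₃ : CMPointedPencilVHC) : CMFibreAlgebraicLift :=
  cmFibreAlgebraicLift_of_cmAnchoredTransport_of_verdier hGT (cmAnchoredTransport_of_cmPointedPencilVHC h₃)

/-- **(3) ⟺ [(L∀) on CM-pointed pencils], granted Verdier** — part XVII-e's lattice form
`(j_s^*)⁻¹N^p(𝒳_s) = N^p(𝒳) ⊔ ker j_s^*` at every fibre of every CM-pointed compact pencil, the conjunct (L) now
supplied by (3). [cite: Milne2020HodgeClassesAV, Prop. 1 (p. 7)] [cite: Andre1996Motifs, §6.3 (p. 33)] -/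
theorem cmPointed_algebraicFixedPart_iff_cmPointedPencilVHC_of_verdier (hGT : Verdier1976_genericLocalTriviality) :
    (∀ ⦃d : ℕ⦄ ⦃𝒳 S : SchemeOver ℂ⦄ (f : 𝒳 ⟶ S) (hf : IsCompactAbelianPencil f d), (cmLocus f d).Nonempty →
      ∀ (p : ℕ) (s : ComplexPoints S),
        (algebraicClasses (fiberOver f s) p).comap (complexBetti.map (fiberι f s) (2 * p)).hom =
          algebraicClasses 𝒳 p ⊔ LinearMap.ker (complexBetti.map (fiberι f s) (2 * p)).hom) ↔
      CMPointedPencilVHC := by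
  rw [algebraicFixedPart_cmPointed_iff]
  exact ⟨fun h ↦ h.1, fun h ↦ ⟨h, cmFibreAlgebraicLift_of_cmPointedPencilVHC_of_verdier hGT h⟩⟩

/-- **The ladder collapses to (L∀) ⟺ (2) ⟹ (3) ⟹ (4) ⟺ (L), granted Verdier** (the edges (3) ⟹ (2) and
(4) ⟹ (3) — transport INTO non-anchored / CM fibres — stay OPEN without `HC_CM`).
[cite: Andre1996Motifs, §6.3 Remarque 2 (p. 33)] [cite: Verdier1976, Cor. (5.1)] -/
theorem liftLadder_of_verdier (hGT : Verdier1976_genericLocalTriviality) :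
    (AlgebraicFixedPart ↔ CompactAbelianPencilVHC) ∧ (CompactAbelianPencilVHC → CMPointedPencilVHC) ∧
      (CMPointedPencilVHC → CMAnchoredTransport) ∧ (CMAnchoredTransport ↔ CMFibreAlgebraicLift) :=
  ⟨algebraicFixedPart_iff_compactAbelianPencilVHC_of_verdier hGT, cmPointedPencilVHC_of_compactAbelianPencilVHC,
    cmAnchoredTransport_of_cmPointedPencilVHC, (cmFibreAlgebraicLift_iff_cmAnchoredTransport_of_verdier hGT).symm⟩

/-- **ON-PATH: `HC_AV ⟹ (L∀)`, granted Verdier** (HC for the abelian FIBRES only, then the engine).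
[cite: CharlesSchnell2014Notes, Cor. 11.3.6 (p. 494)] [cite: Verdier1976, Cor. (5.1)] -/
theorem algebraicFixedPart_of_HC_AV_of_verdier (hGT : Verdier1976_genericLocalTriviality)
    (h : PadicSemiregularLift.HodgeAbelianVarieties) : AlgebraicFixedPart :=
  algebraicFixedPart_of_compactAbelianPencilVHC_of_verdier hGT (compactAbelianPencilVHC_of_HC_AV h)

/-- **ON-PATH: `HC_AV ⟹ (L)`, granted Verdier.** [cite: CharlesSchnell2014Notes, Cor. 11.3.6 (p. 494)] -/
theorem cmFibreAlgebraicLift_of_HC_AV_of_verdier (hGT : Verdier1976_genericLocalTriviality)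
    (h : PadicSemiregularLift.HodgeAbelianVarieties) : CMFibreAlgebraicLift :=
  cmFibreAlgebraicLift_of_cmAnchoredTransport_of_verdier hGT (cmAnchoredTransport_of_HC_AV h)

/-- **EXACTNESS of (L), granted Lemme 6.3.1 and Verdier: `HC_AV ⟺ HC_CM ∧ CMFibreAlgebraicLift`.** `HC_CM`, `h₂₁`
BINDERS. research route, not a corollary; conditional on HC_CM plus one named minimal statement.
[cite: Andre1996Motifs, Lemme 6.3.1 (p. 31) and Remarque 2 (p. 33)] [cite: Verdier1976, Cor. (5.1)] -/
theorem HC_AV_iff_HC_CM_and_cmFibreAlgebraicLift_of_verdier (h₂₁ : andre1996_cmAnchoredPencil)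
    (hGT : Verdier1976_genericLocalTriviality) :
    PadicSemiregularLift.HodgeAbelianVarieties ↔ (RankFourFaces.CMAbelianHodge ∧ CMFibreAlgebraicLift) :=
  ⟨fun h ↦ ⟨HC_CM_of_HC_AV h, cmFibreAlgebraicLift_of_HC_AV_of_verdier hGT h⟩,
    fun h ↦ HC_AV_of_HC_CM_and_cmFibreAlgebraicLift h₂₁ h.1 h.2⟩

/-- **EXACTNESS of (L∀), granted Lemme 6.3.1 and Verdier: `HC_AV ⟺ HC_CM ∧ AlgebraicFixedPart`.**
[cite: Andre1996Motifs, Lemme 6.3.1 (p. 31) and Remarque 2 (p. 33)] [cite: Milne2020HodgeClassesAV, Prop. 1 (p. 7)] -/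
theorem HC_AV_iff_HC_CM_and_algebraicFixedPart_of_verdier (h₂₁ : andre1996_cmAnchoredPencil)
    (hGT : Verdier1976_genericLocalTriviality) :
    PadicSemiregularLift.HodgeAbelianVarieties ↔ (RankFourFaces.CMAbelianHodge ∧ AlgebraicFixedPart) :=
  ⟨fun h ↦ ⟨HC_CM_of_HC_AV h, algebraicFixedPart_of_HC_AV_of_verdier hGT h⟩,
    fun h ↦ HC_AV_of_HC_CM_and_cmFibreAlgebraicLift h₂₁ h.1 (cmFibreAlgebraicLift_of_algebraicFixedPart h.2)⟩

/-- **The reduction item in lift form, granted Lemme 6.3.1 and Verdier**: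
`CMToAbelian ⟺ (HC_CM → CMFibreAlgebraicLift)`. Nothing closes the item. [cite: Andre1996Motifs, Remarque 2 (p. 33)] -/
theorem cmToAbelian_iff_HC_CM_imp_cmFibreAlgebraicLift_of_verdier (h₂₁ : andre1996_cmAnchoredPencil)
    (hGT : Verdier1976_genericLocalTriviality) :
    RankFourFaces.CMToAbelian ↔ (RankFourFaces.CMAbelianHodge → CMFibreAlgebraicLift) := by
  rw [cmToAbelian_iff_HC_CM_imp_cmAnchoredTransport h₂₁]
  exact ⟨fun h hCM ↦ cmFibreAlgebraicLift_of_cmAnchoredTransport_of_verdier hGT (h hCM),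
    fun h hCM ↦ cmAnchoredTransport_of_cmFibreAlgebraicLift (h hCM)⟩

/-- **Under `HC_CM` (and Lemme 6.3.1, Verdier) ALL FIVE André-axis nodes COINCIDE.** `HC_CM`, `h₂₁` BINDERS.
[cite: Andre1996Motifs, Remarque 2 (p. 33)] [cite: Verdier1976, Cor. (5.1)] -/
theorem liftCandidates_iff_of_HC_CM_of_verdier (h₂₁ : andre1996_cmAnchoredPencil)
    (hCM : RankFourFaces.CMAbelianHodge) (hGT : Verdier1976_genericLocalTriviality) :
    (AlgebraicFixedPart ↔ CMAnchoredTransport) ∧ (CMFibreAlgebraicLift ↔ CMAnchoredTransport) ∧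
      (CMPointedPencilVHC ↔ CMAnchoredTransport) ∧ (CompactAbelianPencilVHC ↔ CMAnchoredTransport) :=
  ⟨⟨fun h ↦ cmAnchoredTransport_of_cmFibreAlgebraicLift (cmFibreAlgebraicLift_of_algebraicFixedPart h),
      fun h ↦ algebraicFixedPart_of_HC_AV_of_verdier hGT (HC_AV_of_HC_CM_and_Bmin h₂₁ hCM h)⟩,
    cmFibreAlgebraicLift_iff_cmAnchoredTransport_of_verdier hGT, (candidates_iff_of_HC_CM h₂₁ hCM).2,
    (candidates_iff_of_HC_CM h₂₁ hCM).1⟩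

/-- **ON-PATH: `HC_AV ⟹ Num^CM`, granted Verdier** (`HC_AV ⟹ (L)` above; `HC_CM ⊢ (L) ⟺ Num^CM`, part XVIII-c).
[cite: CharlesSchnell2014Notes, Cor. 11.3.6 (p. 494)] [cite: Kleiman1968AlgebraicCycles, §3 (D(X))] -/
theorem cmPointedPencilNumerical_of_HC_AV_of_verdier (hGT : Verdier1976_genericLocalTriviality)
    (h : PadicSemiregularLift.HodgeAbelianVarieties) : CMPointedPencilNumerical :=
  (cmFibreAlgebraicLift_iff_cmPointedPencilNumerical_of_HC_CM (HC_CM_of_HC_AV h)).1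
    (cmFibreAlgebraicLift_of_HC_AV_of_verdier hGT h)

/-- **EXACTNESS OF Num^CM, granted Lemme 6.3.1 and Verdier: `HC_AV ⟺ HC_CM ∧ CMPointedPencilNumerical`** —
conjecture D ("hom ≡ num") for the CM-fibre-supported cycles of the total spaces of compact abelian pencils is
EXACTLY what `HC_CM` lacks to give `HC_AV` (part XIX-b's row, re-keyed). `HC_CM`, `h₂₁` BINDERS. research route,
not a corollary; conditional on HC_CM plus one named minimal statement.
[cite: Andre1996Motifs, Lemme 6.3.1 (p. 31) and Remarque 2 (p. 33)] [cite: Kleiman1968AlgebraicCycles, §3 (D(X))]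
[cite: Verdier1976, Cor. (5.1)] -/
theorem HC_AV_iff_HC_CM_and_cmPointedPencilNumerical_of_verdier (h₂₁ : andre1996_cmAnchoredPencil)
    (hGT : Verdier1976_genericLocalTriviality) :
    PadicSemiregularLift.HodgeAbelianVarieties ↔ (RankFourFaces.CMAbelianHodge ∧ CMPointedPencilNumerical) :=
  ⟨fun h ↦ ⟨HC_CM_of_HC_AV h, cmPointedPencilNumerical_of_HC_AV_of_verdier hGT h⟩,
    fun h ↦ HC_AV_of_HC_CM_of_cmPointedPencilNumerical h₂₁ h.1 h.2⟩

/-- **The reduction item in numerical form, granted Lemme 6.3.1 and Verdier**: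
`CMToAbelian ⟺ (HC_CM → CMPointedPencilNumerical)`. Nothing closes the item.
[cite: Andre1996Motifs, Remarque 2 (p. 33)] [cite: Kleiman1968AlgebraicCycles, §3 (D(X))] -/
theorem cmToAbelian_iff_HC_CM_imp_cmPointedPencilNumerical_of_verdier (h₂₁ : andre1996_cmAnchoredPencil)
    (hGT : Verdier1976_genericLocalTriviality) :
    RankFourFaces.CMToAbelian ↔ (RankFourFaces.CMAbelianHodge → CMPointedPencilNumerical) := by
  rw [cmToAbelian_iff_HC_CM_imp_cmFibreAlgebraicLift_of_verdier h₂₁ hGT]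
  exact ⟨fun h hCM ↦ (cmFibreAlgebraicLift_iff_cmPointedPencilNumerical_of_HC_CM hCM).1 (h hCM),
    fun h hCM ↦ (cmFibreAlgebraicLift_iff_cmPointedPencilNumerical_of_HC_CM hCM).2 (h hCM)⟩

/-- **Granted `HC_CM`, Lemme 6.3.1 and Verdier: Num^CM ⟺ (4) ⟺ (3) ⟺ (2) ⟺ (L) ⟺ (L∀)** — each is then equivalent
to `HC_AV`. `HC_CM`, `h₂₁` BINDERS. [cite: Andre1996Motifs, Remarque 2 (p. 33)] [cite: Kleiman1968AlgebraicCycles, §3] -/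
theorem cmPointedPencilNumerical_iff_liftNodes_of_HC_CM_of_verdier (h₂₁ : andre1996_cmAnchoredPencil)
    (hCM : RankFourFaces.CMAbelianHodge) (hGT : Verdier1976_genericLocalTriviality) :
    (CMPointedPencilNumerical ↔ CMAnchoredTransport) ∧ (CMPointedPencilNumerical ↔ CMFibreAlgebraicLift) ∧
      (CMPointedPencilNumerical ↔ AlgebraicFixedPart) ∧ (CMPointedPencilNumerical ↔ CompactAbelianPencilVHC) := by
  have hN : CMPointedPencilNumerical ↔ PadicSemiregularLift.HodgeAbelianVarieties :=
    ⟨fun h ↦ HC_AV_of_HC_CM_of_cmPointedPencilNumerical h₂₁ hCM h,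
      fun h ↦ cmPointedPencilNumerical_of_HC_AV_of_verdier hGT h⟩
  obtain ⟨hA, hL, h3, h2⟩ := liftCandidates_iff_of_HC_CM_of_verdier h₂₁ hCM hGT
  have h4 : CMAnchoredTransport ↔ PadicSemiregularLift.HodgeAbelianVarieties :=
    ⟨fun h ↦ HC_AV_of_HC_CM_and_Bmin h₂₁ hCM h, cmAnchoredTransport_of_HC_AV⟩
  exact ⟨hN.trans h4.symm, hN.trans (h4.symm.trans hL.symm), hN.trans (h4.symm.trans hA.symm),
    hN.trans (h4.symm.trans h2.symm)⟩

end Summit.HodgeConjecture.HodgeConjecture.Ring2.AbelianAll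

end
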